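import Summits.BirchSwinnertonDyer.BirchSwinnertonDyer.Theorems.UniversalToricDescentDefectTransportWallStep
import Summits.BirchSwinnertonDyer.BirchSwinnertonDyer.Theorems.UniversalToricDescentSigmaLocalProductAnyTorsion
import HarnessLib

/-!
# Route UniversalToricDescent — the algebraic half of ♭T′ `DefectTransportModThreePT` WITHOUT (iv) and WITHOUT the
# twin's base finiteness, CLOSED MODULO three residual inputs (M1)–(M3); and modulo (M1) alone given the twin's
# base finiteness

Lead prover bsd-wall-utd-p1 g13 (`--supports` ♭T′ stmt-BirchSwinnertonDyer-26975; FRAME of the registered stub B′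
`stub_lambdaTransportPT`, line `sigmacongruence`). p610218 `defectTransport_algebraicHalf_lambda_of_wall` consumes (iv)
`E(ℚ₃)[3] = 0` (false on 206 habitat classes) and `Sel_v(K, E′[3^∞]) < ∞` (false for twins of `K`-rank ≥ 2). After the
`anyTorsion` port of the `Σ`-machinery (`…SigmaCoinvariantsAnyTorsion`, `…SigmaLocalSurjectiveAnyTorsion`,
`…SigmaLocalProductAnyTorsion`), (iv) enters at ONE point and the twin's base finiteness at TWO; here they are
explicit hypotheses on tree objects: (M1) `hcmp` — `#Sel_{𝔭′}^Σ(K_∞, E[3^∞])[3] = #Sel_{𝔭′}^Σ(K_∞, E′[3^∞])[3]` at the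
bad set `Σ` (tree: under (L) `E[3]^{G_{K_{∞,𝔭′}}} = 0`, `natCard_selmerAc_pTorsion_eq_of_torsionIso`; (L)-free it needs the
residual surjectivity onto `⊕_{w∣𝔭′} H¹(K_{∞,w}, E[3])`); (M2) `hnf'` — no non-zero finite `Λ`-submodule of
`X_{∅,0}(E′)` (Greenberg–Vatsal Prop. 2.5 / Greenberg LNM 4.15 at arbitrary `K`-rank; the (L10) road is closed when
`rank E′(K) ≥ 2`); (M3) `hprodTwin` — the twin's `Σ`-product (GV Prop. 2.1 / Cor. 2.3).

* §1 `defectTransport_algebraicHalf_of_residualComparison` — twin torsion, generator of profile `λ_alg(E′)`,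
  `3^n · #B^Σ(E)[3] = 3^{λ_alg(E′)} · #B^Σ(E′)[3]` from (M1) + (N1) ×2 at `∅`; no (iv), no congruence hypothesis.
* §2 `defectTransport_algebraicHalf_lambda_of_wall_of_residual` — **B′'s conclusion VERBATIM from B′'s hypotheses +
  (M1) + (M2) + (M3)** (the wild curve's (N1) and `Σ`-product from its base finiteness by the `anyTorsion` files).
* §3 `defectTransport_algebraicHalf_lambda_of_wall_of_residualComparison` — **B′'s conclusion from B′'s hypotheses +
  the twin's base finiteness + (M1) ALONE**: (iv) is retired from stub B′ up to (M1).

HONEST STATUS: helper theorems, CONDITIONAL on the cited Poitou–Tate facts; (M1)–(M3) are hypotheses; stubs A, B′ and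
♭T′ stay open. THEOREMS ONLY; no definition, no named fact, no `sorry`. BSD is not advanced by this file. References:
[GreenbergVatsal2000] Thm. (1.4), §2 (2.1)–(2.10) (pp. 23–28); [GreenbergLNM1716] Prop. 4.14–4.15; [MilneADT2006] I 4.10.
-/
set_option autoImplicit false
-- `…BirchSwinnertonDyer.BirchSwinnertonDyer.Theorems…` is the problem's mandated namespace (D-0017).
set_option linter.dupNamespace false

noncomputable section
open scoped Classical

namespace Summit.BirchSwinnertonDyer.BirchSwinnertonDyer.Theorems.UniversalToricDescentDefectTransport

open Function Field NumberField IsDedekindDomain WeierstrassCurve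
open Literature.NumberTheory.GaloisRepresentations Literature.NumberTheory.EllipticCurves
  Literature.NumberTheory.EllipticCurves.GreenbergSelmer Literature.NumberTheory.GaloisCohomology
  Literature.NumberTheory.EllipticCurves.IwasawaAlgebra Literature.NumberTheory.EllipticCurves.Rank1Residual
  Summit.BirchSwinnertonDyer.Rank1Residual Summit.BirchSwinnertonDyer.Rank1Residual.X11b
  Summit.BirchSwinnertonDyer.Rank1Residual.X11b.Coinv Summit.BirchSwinnertonDyer.Rank1Residual.X11b.AcSelmer
  Summit.BirchSwinnertonDyer.Rank1Residual.X11b.LocBridge Summit.BirchSwinnertonDyer.Rank1Residual.Iwasawa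
  Summit.BirchSwinnertonDyer.BirchSwinnertonDyer.Theorems.UniversalToricDescentSigmaPassage
  Summit.BirchSwinnertonDyer.BirchSwinnertonDyer.Theorems.UniversalToricDescentNoFiniteSubmodule
  Summit.BirchSwinnertonDyer.BirchSwinnertonDyer.Theorems.UniversalToricDescentSigmaLocalImage
  Summit.BirchSwinnertonDyer.BirchSwinnertonDyer.Theorems.UniversalToricDescentSigmaLocalStabilizer
  Summit.BirchSwinnertonDyer.BirchSwinnertonDyer.Theorems.UniversalToricDescentSigmaFree
  Summit.BirchSwinnertonDyer.BirchSwinnertonDyer.Theorems.UniversalToricDescentSigmaCoinvariants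
  Summit.BirchSwinnertonDyer.BirchSwinnertonDyer.Theorems.UniversalToricDescentAcDualMuZero
  Summit.BirchSwinnertonDyer.BirchSwinnertonDyer.Theorems.UniversalToricDescentLambdaNormProfile
  Summit.BirchSwinnertonDyer.BirchSwinnertonDyer.Theorems.UniversalToricDescentTorsionMuTransportHeegner

/-! ### §1 The `Σ`-free count from the residual comparison (M1), no (iv) -/

/-- **Algebraic half of ♭T′, direction `E → E′`, from the residual comparison (M1)** (source `X_{∅,0}(E)` torsion,
`Ch·R₀⟦T⟧ = (g)`, `profile_n(g)`; (N1) ×2 at `∅`; (M1) at the bad set): the twin's `X_{∅,0}(E′)` is torsion, has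
a generator of profile `λ_alg(E′)`, and `3^{n} · #(Sel^Σ/Sel^∅)(E)[3] = 3^{λ_alg(E′)} · #(Sel^Σ/Sel^∅)(E′)[3]`. No (iv),
no congruence hypothesis (both entered g11's `defectTransport_algebraicHalf` only through (M1)).
[cite: GreenbergVatsal2000, Thm. (1.4), §2 Prop. (2.8) and (2.10) (pp. 26–28)] [cite: Brink2007, Thm. 2 and Cor. 1] -/
theorem defectTransport_algebraicHalf_of_residualComparison (W W' : WeierstrassCurve ℚ) [W.IsElliptic]
    [W.IsGloballyMinimal] [W'.IsElliptic] {N N' : ℕ} (K : Type) [Field K] [NumberField K]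
    (hN : W.conductorNorm ℤ = N) (hN' : W'.conductorNorm ℤ = N') (hK : IsImaginaryQuadratic K)
    (hHe : SatisfiesHeegnerHypothesis N K) (hHe' : SatisfiesHeegnerHypothesis N' K)
    (κ : ZpExtension K 3) (hκ : κ.IsAnticyclotomic) (γ : absoluteGaloisGroup K)
    [Fact (κ.IsTopGenerator γ)] {𝔭' : HeightOneSpectrum (𝓞 K)}
    (hT : Module.IsTorsion (IwasawaAlgebra 3) (XAc (W.baseChange K) 3 κ 𝔭' ∅ γ))
    {g : UnrSeries 3} {n : ℕ}
    (hg : (XAc.charIdeal (W.baseChange K) 3 κ 𝔭' ∅ γ).map (PowerSeries.map (Halves.toUnr 3)) =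
      Ideal.span {g})
    (hn : (∀ i < n, ‖((PowerSeries.coeff i g : unrIntegers 3) : ℂ_[3])‖ < 1) ∧
      ‖((PowerSeries.coeff n g : unrIntegers 3) : ℂ_[3])‖ = 1)
    (hnf : ∀ M : Submodule (IwasawaAlgebra 3) (XAc (W.baseChange K) 3 κ 𝔭' ∅ γ), Finite M → M = ⊥)
    (hnf' : ∀ M : Submodule (IwasawaAlgebra 3) (XAc (W'.baseChange K) 3 κ 𝔭' ∅ γ), Finite M → M = ⊥)
    (hcmp : Nat.card {s : selmerAc (W.baseChange K) 3 κ 𝔭'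
        {v | ((3 : ℕ) : 𝓞 K) ∉ v.asIdeal ∧ (¬ (W.baseChange K).HasGoodReductionAt v ∨
          ¬ (W'.baseChange K).HasGoodReductionAt v)} // 3 • s = 0} =
      Nat.card {s : selmerAc (W'.baseChange K) 3 κ 𝔭'
        {v | ((3 : ℕ) : 𝓞 K) ∉ v.asIdeal ∧ (¬ (W.baseChange K).HasGoodReductionAt v ∨
          ¬ (W'.baseChange K).HasGoodReductionAt v)} // 3 • s = 0}) :
    Module.IsTorsion (IwasawaAlgebra 3) (XAc (W'.baseChange K) 3 κ 𝔭' ∅ γ) ∧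
      ∃ g' : UnrSeries 3,
        (XAc.charIdeal (W'.baseChange K) 3 κ 𝔭' ∅ γ).map (PowerSeries.map (Halves.toUnr 3)) =
            Ideal.span {g'} ∧
          (∀ i < lambdaInvariant 3 (XAc (W'.baseChange K) 3 κ 𝔭' ∅ γ),
            ‖((PowerSeries.coeff i g' : unrIntegers 3) : ℂ_[3])‖ < 1) ∧
          ‖((PowerSeries.coeff (lambdaInvariant 3 (XAc (W'.baseChange K) 3 κ 𝔭' ∅ γ)) g' :
            unrIntegers 3) : ℂ_[3])‖ = 1 ∧
          3 ^ n *
              Nat.card {b : selmerAc (W.baseChange K) 3 κ 𝔭'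
                  {v | ((3 : ℕ) : 𝓞 K) ∉ v.asIdeal ∧ (¬ (W.baseChange K).HasGoodReductionAt v ∨
                    ¬ (W'.baseChange K).HasGoodReductionAt v)} ⧸
                (selmerAc (W.baseChange K) 3 κ 𝔭' ∅).addSubgroupOf
                  (selmerAc (W.baseChange K) 3 κ 𝔭'
                    {v | ((3 : ℕ) : 𝓞 K) ∉ v.asIdeal ∧ (¬ (W.baseChange K).HasGoodReductionAt v ∨
                      ¬ (W'.baseChange K).HasGoodReductionAt v)}) // 3 • b = 0} =
            3 ^ lambdaInvariant 3 (XAc (W'.baseChange K) 3 κ 𝔭' ∅ γ) *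
              Nat.card {b : selmerAc (W'.baseChange K) 3 κ 𝔭'
                  {v | ((3 : ℕ) : 𝓞 K) ∉ v.asIdeal ∧ (¬ (W.baseChange K).HasGoodReductionAt v ∨
                    ¬ (W'.baseChange K).HasGoodReductionAt v)} ⧸
                (selmerAc (W'.baseChange K) 3 κ 𝔭' ∅).addSubgroupOf
                  (selmerAc (W'.baseChange K) 3 κ 𝔭'
                    {v | ((3 : ℕ) : 𝓞 K) ∉ v.asIdeal ∧ (¬ (W.baseChange K).HasGoodReductionAt v ∨
                      ¬ (W'.baseChange K).HasGoodReductionAt v)}) // 3 • b = 0} := by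
  haveI : Fact (Nat.Prime 3) := ⟨Nat.prime_three⟩
  -- `Σ` := the places prime to `3` where one of the two curves has bad reduction
  set S : Set (HeightOneSpectrum (𝓞 K)) := {v | ((3 : ℕ) : 𝓞 K) ∉ v.asIdeal ∧
    (¬ (W.baseChange K).HasGoodReductionAt v ∨ ¬ (W'.baseChange K).HasGoodReductionAt v)} with hSdef
  have hSfin : S.Finite := by
    refine (((W.baseChange K).finite_badPlaces_holds (𝓞 K)).union
      ((W'.baseChange K).finite_badPlaces_holds (𝓞 K))).subset fun v hv ↦ ?_
    rcases hv.2 with h | h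
    · exact Or.inl h
    · exact Or.inr h
  have hSp : ∀ v ∈ S, ((3 : ℕ) : 𝓞 K) ∉ v.asIdeal := fun v hv ↦ hv.1
  have hSdec : ∀ v ∈ S, ¬ (decomp v ≤ κ.kerSubgroup) := by
    intro v hv
    rcases hv.2 with h | h
    · exact not_decomp_le_kerSubgroup_of_not_hasGoodReductionAt_baseChange W hN K hK hHe (by decide) κ
        hκ hv.1 h
    · exact not_decomp_le_kerSubgroup_of_not_hasGoodReductionAt_baseChange W' hN' K hK hHe' (by decide)
        κ hκ hv.1 h
  -- the wild curve: `μ = 0` and `λ = n` at `Σ = ∅`, then `Sel^Σ[3]` finite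
  haveI := XAc.module_finite κ 𝔭' (∅ : Set (HeightOneSpectrum (𝓞 K))) γ Set.finite_empty
    (W := W.baseChange K)
  have hμe : muInvariant 3 (XAc (W.baseChange K) 3 κ 𝔭' ∅ γ) = 0 :=
    muInvariant_eq_zero_of_map_charIdeal_eq_span (XAc (W.baseChange K) 3 κ 𝔭' ∅ γ) hT hg ⟨n, hn.2⟩
  have hlam : lambdaInvariant 3 (XAc (W.baseChange K) 3 κ 𝔭' ∅ γ) = n :=
    lambdaInvariant_eq_of_generator_normProfile (W.baseChange K) 3 κ 𝔭' ∅ γ Set.finite_empty hT hμe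
      hg hn
  have hfine : Set.Finite {s : selmerAc (W.baseChange K) 3 κ 𝔭' ∅ | 3 • s = 0} :=
    finite_pTorsion_of_muInvariant_eq_zero (W.baseChange K) 3 κ 𝔭' ∅ γ hT hμe
  have hfinS : Set.Finite {s : selmerAc (W.baseChange K) 3 κ 𝔭' S | 3 • s = 0} :=
    finite_selmerAc_pTorsion_of_empty (W.baseChange K) κ hSfin hSp hSdec hfine
  -- the twin: `Sel^Σ(E′)[3]` is finite by (M1), hence torsion + `μ = 0` at `Σ` and at `∅` (criterion (A))
  have hfinS' : Set.Finite {s : selmerAc (W'.baseChange K) 3 κ 𝔭' S | 3 • s = 0} := by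
    have hfin₁ : Finite {s : selmerAc (W.baseChange K) 3 κ 𝔭' S // 3 • s = 0} := hfinS.to_subtype
    have h0 : Nat.card {s : selmerAc (W.baseChange K) 3 κ 𝔭' S // 3 • s = 0} ≠ 0 := by
      haveI : Nonempty {s : selmerAc (W.baseChange K) 3 κ 𝔭' S // 3 • s = 0} := ⟨⟨0, smul_zero 3⟩⟩
      exact Nat.card_pos.ne'
    have : Finite {s : selmerAc (W'.baseChange K) 3 κ 𝔭' S // 3 • s = 0} := by
      apply Nat.finite_of_card_ne_zero; rw [← hcmp]; exact h0
    exact Set.finite_coe_iff.mp this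
  have hfine' := finite_selmerAc_pTorsion_empty_of (W'.baseChange K) κ hfinS'
  have hT' : Module.IsTorsion (IwasawaAlgebra 3) (XAc (W'.baseChange K) 3 κ 𝔭' ∅ γ) :=
    isTorsion_of_finite_pTorsion (W'.baseChange K) 3 κ 𝔭' ∅ γ Set.finite_empty hfine'
  have hμ' : muInvariant 3 (XAc (W'.baseChange K) 3 κ 𝔭' ∅ γ) = 0 :=
    muInvariant_eq_zero_of_finite_pTorsion (W'.baseChange K) 3 κ 𝔭' ∅ γ Set.finite_empty hfine'
  -- the count: both sides equal `#Sel^Σ(E_i)[3]`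
  have hcount : 3 ^ lambdaInvariant 3 (XAc (W.baseChange K) 3 κ 𝔭' ∅ γ) *
        Nat.card {b : selmerAc (W.baseChange K) 3 κ 𝔭' S ⧸
          (selmerAc (W.baseChange K) 3 κ 𝔭' ∅).addSubgroupOf (selmerAc (W.baseChange K) 3 κ 𝔭' S) //
            3 • b = 0} =
      3 ^ lambdaInvariant 3 (XAc (W'.baseChange K) 3 κ 𝔭' ∅ γ) *
        Nat.card {b : selmerAc (W'.baseChange K) 3 κ 𝔭' S ⧸
          (selmerAc (W'.baseChange K) 3 κ 𝔭' ∅).addSubgroupOf (selmerAc (W'.baseChange K) 3 κ 𝔭' S) //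
            3 • b = 0} := by
    rw [pow_lambdaInvariant_mul_natCard_eq (W.baseChange K) 3 κ 𝔭' S γ hT hμe hnf,
      pow_lambdaInvariant_mul_natCard_eq (W'.baseChange K) 3 κ 𝔭' S γ hT' hμ' hnf']
    exact hcmp
  -- the twin's generator with profile `λ_alg(E′)`
  obtain ⟨g', hg', hglt', hgeq'⟩ :=
    exists_generator_normProfile_lambdaInvariant (W'.baseChange K) 3 κ 𝔭' ∅ γ Set.finite_empty hT' hμ'
  refine ⟨hT', g', hg', hglt', hgeq', ?_⟩
  rw [← hlam]
  exact hcount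

/-! ### §2 B′'s conclusion from B′'s hypotheses + (M1) + (M2) + (M3) -/

/-- **Stub B′'s conclusion VERBATIM from the wall + the wild curve's base finiteness + (M1) + (M2) + (M3)** — NO
(iv), NO base finiteness of the twin, no congruence hypothesis (consumed inside (M1)). Wild side: `μ(X_E) = 0` from
the wall, (N1) and the `Σ`-product from Poitou–Tate ×2 + `Sel_v(K, E[3^∞]) < ∞` by the `anyTorsion` files.
[cite: GreenbergVatsal2000, Thm. (1.4), §2 Prop. (2.1), Cor. (2.3), (2.4), (2.5), (2.8), (2.10) (pp. 23–28)]
[cite: JetchevSkinnerWan2017, Lemma 3.3.3 (arXiv:1512.06894 pp. 11–12)] [cite: MilneADT2006, Ch. I, Thm. 4.10] -/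
theorem defectTransport_algebraicHalf_lambda_of_wall_of_residual (W W' : WeierstrassCurve ℚ) [W.IsElliptic]
    [W.IsGloballyMinimal] [W'.IsElliptic] [W'.IsGloballyMinimal] {N N' : ℕ} (K : Type) [Field K]
    [NumberField K]
    (hO6 : Additive.ClassO6 W 3) (hN : W.conductorNorm ℤ = N) (hN' : W'.conductorNorm ℤ = N')
    (hK : IsImaginaryQuadratic K)
    (hHe : SatisfiesHeegnerHypothesis N K) (hHe' : SatisfiesHeegnerHypothesis N' K)
    (κ : ZpExtension K 3) (hκ : κ.IsAnticyclotomic) (γ : absoluteGaloisGroup K)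
    [Fact (κ.IsTopGenerator γ)] {𝔭' : HeightOneSpectrum (𝓞 K)} (h𝔭' : ((3 : ℕ) : 𝓞 K) ∈ 𝔭'.asIdeal)
    (hT : Module.IsTorsion (IwasawaAlgebra 3) (XAc (W.baseChange K) 3 κ 𝔭' ∅ γ))
    {L : UnrSeries 3}
    (hle : Ideal.span {L} ≤
      (XAc.charIdeal (W.baseChange K) 3 κ 𝔭' ∅ γ).map (PowerSeries.map (Halves.toUnr 3)))
    (hi : ∃ i : ℕ, ‖((PowerSeries.coeff i L : unrIntegers 3) : ℂ_[3])‖ = 1)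
    (hPT : poitouTate_selmerStructure_duality K) (hPT2 : poitouTate_sha_tateDual K)
    (hfin : ∀ v : HeightOneSpectrum (𝓞 K), ((3 : ℕ) : 𝓞 K) ∈ v.asIdeal →
      Finite (selmerAcBase (W.baseChange K) 3 v ∅))
    (hcmp : Nat.card {s : selmerAc (W.baseChange K) 3 κ 𝔭'
        {v | ((3 : ℕ) : 𝓞 K) ∉ v.asIdeal ∧ (¬ (W.baseChange K).HasGoodReductionAt v ∨
          ¬ (W'.baseChange K).HasGoodReductionAt v)} // 3 • s = 0} =
      Nat.card {s : selmerAc (W'.baseChange K) 3 κ 𝔭'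
        {v | ((3 : ℕ) : 𝓞 K) ∉ v.asIdeal ∧ (¬ (W.baseChange K).HasGoodReductionAt v ∨
          ¬ (W'.baseChange K).HasGoodReductionAt v)} // 3 • s = 0})
    (hnf' : ∀ M : Submodule (IwasawaAlgebra 3) (XAc (W'.baseChange K) 3 κ 𝔭' ∅ γ), Finite M → M = ⊥)
    (hprodTwin : ∀ (hS : Set.Finite {v : HeightOneSpectrum (𝓞 K) | ((3 : ℕ) : 𝓞 K) ∉ v.asIdeal ∧
        (¬ (W.baseChange K).HasGoodReductionAt v ∨ ¬ (W'.baseChange K).HasGoodReductionAt v)})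
        (c : HeightOneSpectrum (𝓞 K) → ℕ),
        (∀ v ∈ {v : HeightOneSpectrum (𝓞 K) | ((3 : ℕ) : 𝓞 K) ∉ v.asIdeal ∧
          (¬ (W.baseChange K).HasGoodReductionAt v ∨ ¬ (W'.baseChange K).HasGoodReductionAt v)},
          ∀ z : ℤ_[3], ∃ d : decomp (K := K) v,
            (κ (d : absoluteGaloisGroup K)).toAdd = (3 : ℤ_[3]) ^ c v * z) →
        (∀ v ∈ {v : HeightOneSpectrum (𝓞 K) | ((3 : ℕ) : 𝓞 K) ∉ v.asIdeal ∧
          (¬ (W.baseChange K).HasGoodReductionAt v ∨ ¬ (W'.baseChange K).HasGoodReductionAt v)},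
          ∀ d : decomp (K := K) v, (3 : ℤ_[3]) ^ c v ∣ (κ (d : absoluteGaloisGroup K)).toAdd) →
        Set.Finite {s : selmerAc (W'.baseChange K) 3 κ 𝔭'
          {v | ((3 : ℕ) : 𝓞 K) ∉ v.asIdeal ∧ (¬ (W.baseChange K).HasGoodReductionAt v ∨
            ¬ (W'.baseChange K).HasGoodReductionAt v)} | 3 • s = 0} →
        Nat.card {b : selmerAc (W'.baseChange K) 3 κ 𝔭'
            {v | ((3 : ℕ) : 𝓞 K) ∉ v.asIdeal ∧ (¬ (W.baseChange K).HasGoodReductionAt v ∨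
              ¬ (W'.baseChange K).HasGoodReductionAt v)} ⧸
          (selmerAc (W'.baseChange K) 3 κ 𝔭' ∅).addSubgroupOf (selmerAc (W'.baseChange K) 3 κ 𝔭'
            {v | ((3 : ℕ) : 𝓞 K) ∉ v.asIdeal ∧ (¬ (W.baseChange K).HasGoodReductionAt v ∨
              ¬ (W'.baseChange K).HasGoodReductionAt v)}) // 3 • b = 0} =
        ∏ v ∈ hS.toFinset, Nat.card {f : subgroupH1 (kerD κ v) ((W'.baseChange K).geomPrimaryTorsion 3) //
          3 • f = 0} ^ (3 ^ c v)) :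
    ∃ (T : Finset (HeightOneSpectrum (𝓞 K))) (c s s' : HeightOneSpectrum (𝓞 K) → ℕ),
      (↑T = {v : HeightOneSpectrum (𝓞 K) | ((3 : ℕ) : 𝓞 K) ∉ v.asIdeal ∧
        (¬ (W.baseChange K).HasGoodReductionAt v ∨ ¬ (W'.baseChange K).HasGoodReductionAt v)}) ∧
      (∀ v ∈ T, (∃ d₀ : decomp (K := K) v, (κ (d₀ : absoluteGaloisGroup K)).toAdd = (3 : ℤ_[3]) ^ c v) ∧
        (∀ d : decomp (K := K) v, (3 : ℤ_[3]) ^ c v ∣ (κ (d : absoluteGaloisGroup K)).toAdd) ∧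
        Nat.card {f : subgroupH1 (kerD κ v) ((W.baseChange K).geomPrimaryTorsion 3) // 3 • f = 0} =
          3 ^ s v ∧
        Nat.card {f : subgroupH1 (kerD κ v) ((W'.baseChange K).geomPrimaryTorsion 3) // 3 • f = 0} =
          3 ^ s' v) ∧
      (∃ g : UnrSeries 3,
        (XAc.charIdeal (W.baseChange K) 3 κ 𝔭' ∅ γ).map (PowerSeries.map (Halves.toUnr 3)) =
            Ideal.span {g} ∧
          (∀ i < lambdaInvariant 3 (XAc (W.baseChange K) 3 κ 𝔭' ∅ γ),
            ‖((PowerSeries.coeff i g : unrIntegers 3) : ℂ_[3])‖ < 1) ∧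
          ‖((PowerSeries.coeff (lambdaInvariant 3 (XAc (W.baseChange K) 3 κ 𝔭' ∅ γ)) g :
            unrIntegers 3) : ℂ_[3])‖ = 1) ∧
      Module.IsTorsion (IwasawaAlgebra 3) (XAc (W'.baseChange K) 3 κ 𝔭' ∅ γ) ∧
      (∃ g' : UnrSeries 3,
        (XAc.charIdeal (W'.baseChange K) 3 κ 𝔭' ∅ γ).map (PowerSeries.map (Halves.toUnr 3)) =
            Ideal.span {g'} ∧
          (∀ i < lambdaInvariant 3 (XAc (W'.baseChange K) 3 κ 𝔭' ∅ γ),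
            ‖((PowerSeries.coeff i g' : unrIntegers 3) : ℂ_[3])‖ < 1) ∧
          ‖((PowerSeries.coeff (lambdaInvariant 3 (XAc (W'.baseChange K) 3 κ 𝔭' ∅ γ)) g' :
            unrIntegers 3) : ℂ_[3])‖ = 1) ∧
      lambdaInvariant 3 (XAc (W.baseChange K) 3 κ 𝔭' ∅ γ) + ∑ v ∈ T, 3 ^ c v * s v =
        lambdaInvariant 3 (XAc (W'.baseChange K) 3 κ 𝔭' ∅ γ) + ∑ v ∈ T, 3 ^ c v * s' v := by
  haveI : Fact (Nat.Prime 3) := ⟨Nat.prime_three⟩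
  -- `Σ` and its finiteness / decomposition data
  set S : Set (HeightOneSpectrum (𝓞 K)) := {v | ((3 : ℕ) : 𝓞 K) ∉ v.asIdeal ∧
    (¬ (W.baseChange K).HasGoodReductionAt v ∨ ¬ (W'.baseChange K).HasGoodReductionAt v)} with hSdef
  have hSfin : S.Finite := by
    refine (((W.baseChange K).finite_badPlaces_holds (𝓞 K)).union
      ((W'.baseChange K).finite_badPlaces_holds (𝓞 K))).subset fun v hv ↦ ?_
    rcases hv.2 with h | h
    · exact Or.inl h
    · exact Or.inr h
  have hSp : ∀ v ∈ S, ((3 : ℕ) : 𝓞 K) ∉ v.asIdeal := fun v hv ↦ hv.1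
  have hSdec : ∀ v ∈ S, ¬ (decomp v ≤ κ.kerSubgroup) := by
    intro v hv
    rcases hv.2 with h | h
    · exact not_decomp_le_kerSubgroup_of_not_hasGoodReductionAt_baseChange W hN K hK hHe (by decide) κ
        hκ hv.1 h
    · exact not_decomp_le_kerSubgroup_of_not_hasGoodReductionAt_baseChange W' hN' K hK hHe' (by decide)
        κ hκ hv.1 h
  choose! c hc₀ hc hdvd using fun v (hv : v ∈ S) ↦ exists_pow_and_forall_dvd_of_not_le κ v (hSdec v hv)
  -- arithmetic of the datum: `3` splits in `K`
  have hadd : Addv W 3 := hO6.2.1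
  have hpN : 3 ∣ W.conductorNorm ℤ :=
    (W.dvd_conductorNorm_iff_not_hasGoodReductionAtPrime 3).mpr hadd.1
  have hsplit : SplitsIn K 3 := hHe 3 (Fact.out) (hN ▸ hpN)
  -- the wild curve: `μ = 0` from the wall, a generator with profile `λ_alg(E)`, (N1) at `∅` WITHOUT (iv)
  haveI := XAc.module_finite κ 𝔭' (∅ : Set (HeightOneSpectrum (𝓞 K))) γ Set.finite_empty
    (W := W.baseChange K)
  have hμe : muInvariant 3 (XAc (W.baseChange K) 3 κ 𝔭' ∅ γ) = 0 :=
    muInvariant_eq_zero_of_span_le_map_charIdeal (XAc (W.baseChange K) 3 κ 𝔭' ∅ γ) hT hle hi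
  obtain ⟨g, hg, hglt, hgeq⟩ :=
    exists_generator_normProfile_lambdaInvariant (W.baseChange K) 3 κ 𝔭' ∅ γ Set.finite_empty hT hμe
  have hnf := (forall_finite_eq_bot_sigma_anyTorsion W 3 hPT hPT2 hK hsplit κ γ h𝔭' hfin ∅).1
  -- `Sel^Σ[3]` of the wild curve is finite
  have hfine : Set.Finite {s : selmerAc (W.baseChange K) 3 κ 𝔭' ∅ | 3 • s = 0} :=
    finite_pTorsion_of_muInvariant_eq_zero (W.baseChange K) 3 κ 𝔭' ∅ γ hT hμe
  have hfinS : Set.Finite {s : selmerAc (W.baseChange K) 3 κ 𝔭' S | 3 • s = 0} :=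
    finite_selmerAc_pTorsion_of_empty (W.baseChange K) κ hSfin hSp hSdec hfine
  -- §1: twin torsion, generator, and the `Σ`-free count
  obtain ⟨hT', g', hg', hglt', hgeq', hcount⟩ := defectTransport_algebraicHalf_of_residualComparison W W'
    K hN hN' hK hHe hHe' κ hκ γ hT hg ⟨hglt, hgeq⟩ hnf hnf' hcmp
  -- `Sel^Σ[3]` of the twin is finite
  haveI := XAc.module_finite κ 𝔭' (∅ : Set (HeightOneSpectrum (𝓞 K))) γ Set.finite_empty
    (W := W'.baseChange K)
  have hμ'e : muInvariant 3 (XAc (W'.baseChange K) 3 κ 𝔭' ∅ γ) = 0 :=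
    muInvariant_eq_zero_of_map_charIdeal_eq_span (XAc (W'.baseChange K) 3 κ 𝔭' ∅ γ) hT' hg'
      ⟨_, hgeq'⟩
  have hfin'e : Set.Finite {s : selmerAc (W'.baseChange K) 3 κ 𝔭' ∅ | 3 • s = 0} :=
    finite_pTorsion_of_muInvariant_eq_zero (W'.baseChange K) 3 κ 𝔭' ∅ γ hT' hμ'e
  have hfin'S : Set.Finite {s : selmerAc (W'.baseChange K) 3 κ 𝔭' S | 3 • s = 0} :=
    finite_selmerAc_pTorsion_of_empty (W'.baseChange K) κ hSfin hSp hSdec hfin'e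
  -- the two local products: the wild curve's WITHOUT (iv), the twin's = (M3)
  have hprod := natCard_quotient_pTorsion_baseChange_eq_prod_anyTorsion W 3 hPT hPT2 hK hsplit κ γ h𝔭'
    hfin hSfin hSp c hc hdvd hfinS
  have hprod' := hprodTwin hSfin c hc hdvd hfin'S
  rw [hprod, hprod'] at hcount
  -- the places of `Σ` and the local exponents
  have hTp : ∀ v ∈ hSfin.toFinset, ((3 : ℕ) : 𝓞 K) ∉ v.asIdeal := fun v hv ↦ hSp v (hSfin.mem_toFinset.mp hv)
  have hTdec : ∀ v ∈ hSfin.toFinset, ¬ (decomp v ≤ κ.kerSubgroup) := fun v hv ↦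
    hSdec v (hSfin.mem_toFinset.mp hv)
  choose! s hs using fun v (hv : v ∈ hSfin.toFinset) ↦
    exists_natCard_pTorsion_subgroupH1_kerD_eq_pow (W.baseChange K) κ (by exact_mod_cast hTp v hv)
      (hTdec v hv)
  choose! s' hs' using fun v (hv : v ∈ hSfin.toFinset) ↦
    exists_natCard_pTorsion_subgroupH1_kerD_eq_pow (W'.baseChange K) κ (by exact_mod_cast hTp v hv)
      (hTdec v hv)
  refine ⟨hSfin.toFinset, c, s, s', hSfin.coe_toFinset, fun v hv ↦ ⟨hc₀ v (hSfin.mem_toFinset.mp hv),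
    hdvd v (hSfin.mem_toFinset.mp hv), hs v hv, hs' v hv⟩, ⟨g, hg, hglt, hgeq⟩, hT', ⟨g', hg', hglt', hgeq'⟩,
    ?_⟩
  -- exponents from the `Nat.card` identity
  have e1 : ∏ v ∈ hSfin.toFinset, Nat.card {f : subgroupH1 (kerD κ v) ((W.baseChange K).geomPrimaryTorsion 3) //
      3 • f = 0} ^ (3 ^ c v) = 3 ^ ∑ v ∈ hSfin.toFinset, 3 ^ c v * s v := by
    rw [← Finset.prod_pow_eq_pow_sum]
    exact Finset.prod_congr rfl fun v hv ↦ by rw [hs v hv, ← pow_mul, Nat.mul_comm (s v)]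
  have e2 : ∏ v ∈ hSfin.toFinset, Nat.card {f : subgroupH1 (kerD κ v) ((W'.baseChange K).geomPrimaryTorsion 3) //
      3 • f = 0} ^ (3 ^ c v) = 3 ^ ∑ v ∈ hSfin.toFinset, 3 ^ c v * s' v := by
    rw [← Finset.prod_pow_eq_pow_sum]
    exact Finset.prod_congr rfl fun v hv ↦ by rw [hs' v hv, ← pow_mul, Nat.mul_comm (s' v)]
  rw [e1, e2, ← pow_add, ← pow_add] at hcount
  exact Nat.pow_right_injective (by norm_num : 2 ≤ 3) hcount

/-! ### §3 B′'s conclusion from B′'s hypotheses + the twin's base finiteness + (M1) alone -/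

/-- **Stub B′'s conclusion from the wall + the twin's base finiteness + (M1) ALONE — (iv) retired up to (M1)**:
(M2) = (N1) at `∅` from `Sel_v(K, E′[3^∞]) < ∞` (`forall_finite_eq_bot_sigma_anyTorsion`), (M3) =
`natCard_quotient_pTorsion_baseChange_eq_prod_anyTorsion` for `E′`; neither uses (iv).
[cite: GreenbergVatsal2000, Thm. (1.4), §2 Prop. (2.8) and (2.10) (pp. 26–28)] [cite: MilneADT2006, Ch. I, Thm. 4.10] -/
theorem defectTransport_algebraicHalf_lambda_of_wall_of_residualComparison (W W' : WeierstrassCurve ℚ)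
    [W.IsElliptic] [W.IsGloballyMinimal] [W'.IsElliptic] [W'.IsGloballyMinimal] {N N' : ℕ} (K : Type) [Field K]
    [NumberField K]
    (hO6 : Additive.ClassO6 W 3) (hN : W.conductorNorm ℤ = N) (hN' : W'.conductorNorm ℤ = N')
    (hK : IsImaginaryQuadratic K)
    (hHe : SatisfiesHeegnerHypothesis N K) (hHe' : SatisfiesHeegnerHypothesis N' K)
    (κ : ZpExtension K 3) (hκ : κ.IsAnticyclotomic) (γ : absoluteGaloisGroup K)
    [Fact (κ.IsTopGenerator γ)] {𝔭' : HeightOneSpectrum (𝓞 K)} (h𝔭' : ((3 : ℕ) : 𝓞 K) ∈ 𝔭'.asIdeal)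
    (hT : Module.IsTorsion (IwasawaAlgebra 3) (XAc (W.baseChange K) 3 κ 𝔭' ∅ γ))
    {L : UnrSeries 3}
    (hle : Ideal.span {L} ≤
      (XAc.charIdeal (W.baseChange K) 3 κ 𝔭' ∅ γ).map (PowerSeries.map (Halves.toUnr 3)))
    (hi : ∃ i : ℕ, ‖((PowerSeries.coeff i L : unrIntegers 3) : ℂ_[3])‖ = 1)
    (hPT : poitouTate_selmerStructure_duality K) (hPT2 : poitouTate_sha_tateDual K)
    (hfin : ∀ v : HeightOneSpectrum (𝓞 K), ((3 : ℕ) : 𝓞 K) ∈ v.asIdeal →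
      Finite (selmerAcBase (W.baseChange K) 3 v ∅))
    (hfin' : ∀ v : HeightOneSpectrum (𝓞 K), ((3 : ℕ) : 𝓞 K) ∈ v.asIdeal →
      Finite (selmerAcBase (W'.baseChange K) 3 v ∅))
    (hcmp : Nat.card {s : selmerAc (W.baseChange K) 3 κ 𝔭'
        {v | ((3 : ℕ) : 𝓞 K) ∉ v.asIdeal ∧ (¬ (W.baseChange K).HasGoodReductionAt v ∨
          ¬ (W'.baseChange K).HasGoodReductionAt v)} // 3 • s = 0} =
      Nat.card {s : selmerAc (W'.baseChange K) 3 κ 𝔭'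
        {v | ((3 : ℕ) : 𝓞 K) ∉ v.asIdeal ∧ (¬ (W.baseChange K).HasGoodReductionAt v ∨
          ¬ (W'.baseChange K).HasGoodReductionAt v)} // 3 • s = 0}) :
    ∃ (T : Finset (HeightOneSpectrum (𝓞 K))) (c s s' : HeightOneSpectrum (𝓞 K) → ℕ),
      (↑T = {v : HeightOneSpectrum (𝓞 K) | ((3 : ℕ) : 𝓞 K) ∉ v.asIdeal ∧
        (¬ (W.baseChange K).HasGoodReductionAt v ∨ ¬ (W'.baseChange K).HasGoodReductionAt v)}) ∧
      (∀ v ∈ T, (∃ d₀ : decomp (K := K) v, (κ (d₀ : absoluteGaloisGroup K)).toAdd = (3 : ℤ_[3]) ^ c v) ∧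
        (∀ d : decomp (K := K) v, (3 : ℤ_[3]) ^ c v ∣ (κ (d : absoluteGaloisGroup K)).toAdd) ∧
        Nat.card {f : subgroupH1 (kerD κ v) ((W.baseChange K).geomPrimaryTorsion 3) // 3 • f = 0} =
          3 ^ s v ∧
        Nat.card {f : subgroupH1 (kerD κ v) ((W'.baseChange K).geomPrimaryTorsion 3) // 3 • f = 0} =
          3 ^ s' v) ∧
      (∃ g : UnrSeries 3,
        (XAc.charIdeal (W.baseChange K) 3 κ 𝔭' ∅ γ).map (PowerSeries.map (Halves.toUnr 3)) =
            Ideal.span {g} ∧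
          (∀ i < lambdaInvariant 3 (XAc (W.baseChange K) 3 κ 𝔭' ∅ γ),
            ‖((PowerSeries.coeff i g : unrIntegers 3) : ℂ_[3])‖ < 1) ∧
          ‖((PowerSeries.coeff (lambdaInvariant 3 (XAc (W.baseChange K) 3 κ 𝔭' ∅ γ)) g :
            unrIntegers 3) : ℂ_[3])‖ = 1) ∧
      Module.IsTorsion (IwasawaAlgebra 3) (XAc (W'.baseChange K) 3 κ 𝔭' ∅ γ) ∧
      (∃ g' : UnrSeries 3,
        (XAc.charIdeal (W'.baseChange K) 3 κ 𝔭' ∅ γ).map (PowerSeries.map (Halves.toUnr 3)) =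
            Ideal.span {g'} ∧
          (∀ i < lambdaInvariant 3 (XAc (W'.baseChange K) 3 κ 𝔭' ∅ γ),
            ‖((PowerSeries.coeff i g' : unrIntegers 3) : ℂ_[3])‖ < 1) ∧
          ‖((PowerSeries.coeff (lambdaInvariant 3 (XAc (W'.baseChange K) 3 κ 𝔭' ∅ γ)) g' :
            unrIntegers 3) : ℂ_[3])‖ = 1) ∧
      lambdaInvariant 3 (XAc (W.baseChange K) 3 κ 𝔭' ∅ γ) + ∑ v ∈ T, 3 ^ c v * s v =
        lambdaInvariant 3 (XAc (W'.baseChange K) 3 κ 𝔭' ∅ γ) + ∑ v ∈ T, 3 ^ c v * s' v := by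
  haveI : Fact (Nat.Prime 3) := ⟨Nat.prime_three⟩
  have hadd : Addv W 3 := hO6.2.1
  have hpN : 3 ∣ W.conductorNorm ℤ :=
    (W.dvd_conductorNorm_iff_not_hasGoodReductionAtPrime 3).mpr hadd.1
  have hsplit : SplitsIn K 3 := hHe 3 (Fact.out) (hN ▸ hpN)
  have hnf' := (forall_finite_eq_bot_sigma_anyTorsion W' 3 hPT hPT2 hK hsplit κ γ h𝔭' hfin' ∅).1
  exact defectTransport_algebraicHalf_lambda_of_wall_of_residual W W' K hO6 hN hN' hK hHe hHe' κ hκ γ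
    h𝔭' hT hle hi hPT hPT2 hfin hcmp hnf'
    (fun hS c hc hdvd hfinS' ↦ natCard_quotient_pTorsion_baseChange_eq_prod_anyTorsion W' 3 hPT hPT2 hK
      hsplit κ γ h𝔭' hfin' hS (fun v hv ↦ hv.1) c hc hdvd hfinS')

end Summit.BirchSwinnertonDyer.BirchSwinnertonDyer.Theorems.UniversalToricDescentDefectTransport

end
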